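import Mathlib.Algebra.BigOperators.Group.Multiset.Basic
import Mathlib.Algebra.Order.Group.Nat
import Mathlib.Data.Multiset.Filter
import Mathlib.Tactic.Ring
import Mathlib.Tactic.Linarith
import HarnessLib

/-!
# Growth increments of `j ↦ log_p #Sel_{p^j}` — support statement S2 of the O5 depth law R1♯
# (cell `b2b-bsdres`, lane CLASS-CLOSURE; o5-r2 GEN 15 `HOME/b2b-bsdres-o5-r2/gen15/R1SHARP-DERIVATION.md`
#  §5 "(★★) + Cassels–Tate, no parity conjecture used" and §7 "S2 growth-increment lemma … pure
#  combinatorics"; cc-eng-5 GEN 43, companion of `O5/CoordinateLagrangianLemma.lean` (S1) and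
#  `O5/CoordinateLagrangianSwap.lean` (the `ℤ/p^k` swap))

HONEST FRAMING (cell `b2b-bsdres`, run/shared/lean/b2b/bsd-rank1-residual/, verbatim in every file):
the goal of the cell is to DELETE the COMBINATION-SHAPED residual classes of the Birch–Swinnerton-Dyer
formula for ALL analytic-rank `≤ 1` elliptic curves over `ℚ` — "full BSD formula for every rank `≤ 1`
curve in class `C`" assembled STRICTLY from published theorems — so that the rank-`≤ 1` remainder
becomes exactly the CONSTRUCTION-SHAPED classes, which are TYPED (missing-input `Prop`s), NOT
attempted. This is not "finishing BSD". This file: THEOREMS ONLY (no definition, no named fact, no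
`@[conjecture]` node, no `sorry`; net named-fact debt `0`); PURE COMBINATORICS of a function
`g : ℕ → ℕ` of the shape `g j = j·r + 2·Σ_{x ∈ m} min(x, j)` (`r : ℕ`, `m` a multiset of POSITIVE
naturals). The ARITHMETIC reading — `g(j) = log_p #Sel_{p^j}(G)` for an elliptic curve `G/ℚ` with
`G(ℚ)[p] = 0` (Kummer sequence: `#Sel_{p^j} = p^{j·rank} · #Ш[p^j]`), `r = rank G(ℚ)`, `m` = HALF the
multiset of elementary-divisor exponents of the finite group `Ш(G)[p^∞] ≅ M ⊕ M` (Cassels–Tate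
alternating pairing), and the HYPOTHESES (★★) on `g` = the output of the `ℤ/p^j` swap run at every level
`j ≤ k` — is NOT asserted here (planner's THEOREM-CANDIDATE `DepthLawThree`; census DEPTH9 = EVIDENCE).
Nothing is booked; no mark of `RESIDUAL-MAP.md` moves; O5 stays OPEN.

## What is proved (R1SHARP §5, clauses (A)–(E), as pure statements about `r`, `m`)
Throughout `hg : ∀ j, g j = j * r + 2 * (m.map (min · j)).sum` and `hpos : ∀ x ∈ m, 0 < x`.
* `succ_eq` (the increment): `g (j+1) = g j + r + 2·#{x ∈ m : j < x}`.
* `const_increments`: if `g (j+1) = g j + c` for all `j < k` (`k ≥ 1`) then `r + 2·card m = c` and every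
  `x ∈ m` is `≥ k`.
* `clause_A` (`r_C = 0`: `g j = j` on `[0, k]`, `k ≥ 1`) ⇒ `r = 1 ∧ m = 0` ("rank G = 1, Ш(G)[p] = 0").
* `clause_B` (`r_C = 1`, depth `d < k`: `g j = 2j` on `[0, d]`, `g j = 2d` on `[d, k]`) ⇒
  `r = 0`, and `m = 0` if `d = 0`, `m = {d}` if `d > 0` ("rank G = 0, Ш(G)[p^∞] ≅ (ℤ/p^d)²").
* `clause_C` (`r_C = 1`, `d ≥ k`: `g j = 2j` on `[0, k]`) ⇒ `(r = 2 ∧ m = 0) ∨ (r = 0 ∧ m = {x}, x ≥ k)`.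
* `clause_D` (`r_C = 2`, `d < k`: `g j = 3j` on `[0, d]`, `g j = j + 2d` on `[d, k]`) ⇒
  `r = 1`, `m = 0` (`d = 0`) / `m = {d}` (`d > 0`).
* `clause_E` (`r_C = 2`, `d ≥ k`: `g j = 3j` on `[0, k]`) ⇒ `(r = 3 ∧ m = 0) ∨ (r = 1 ∧ m = {x}, x ≥ k)`.
-/

namespace Summit.BirchSwinnertonDyer.Rank1Residual.O5.GrowthIncrements

variable {g : ℕ → ℕ} {r : ℕ} {m : Multiset ℕ}

/-- `Σ_{x ∈ m} min(x, j+1) = Σ_{x ∈ m} min(x, j) + #{x ∈ m : j < x}`. [folklore] -/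
theorem sum_map_min_succ (m : Multiset ℕ) (j : ℕ) :
    (m.map (fun x => min x (j + 1))).sum =
      (m.map (fun x => min x j)).sum + Multiset.card (m.filter (fun x => j < x)) := by
  induction m using Multiset.induction_on with
  | empty => simp
  | cons a m ih =>
    by_cases h : j < a
    · rw [Multiset.map_cons, Multiset.sum_cons, Multiset.map_cons, Multiset.sum_cons,
        Multiset.filter_cons_of_pos _ h, Multiset.card_cons, ih]
      have h1 : min a (j + 1) = j + 1 := min_eq_right (by omega)
      have h2 : min a j = j := min_eq_right (by omega)
      rw [h1, h2]
      ring
    · rw [Multiset.map_cons, Multiset.sum_cons, Multiset.map_cons, Multiset.sum_cons,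
        Multiset.filter_cons_of_neg _ h, ih]
      have h1 : min a (j + 1) = a := min_eq_left (by omega)
      have h2 : min a j = a := min_eq_left (by omega)
      rw [h1, h2, add_assoc]

/-- THE INCREMENT: `g (j+1) = g j + r + 2·#{x ∈ m : j < x}` ("`Δ(j) = r_G + #{i : e_i > j}`" with the
invariants doubled). [folklore] -/
theorem succ_eq (hg : ∀ j, g j = j * r + 2 * (m.map (fun x => min x j)).sum) (j : ℕ) :
    g (j + 1) = g j + r + 2 * Multiset.card (m.filter (fun x => j < x)) := by
  rw [hg, hg, sum_map_min_succ]
  ring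

/-- CONSTANT INCREMENTS: if `g (j+1) = g j + c` for every `j < k` (`k ≥ 1`) then `r + 2·card m = c`
and every element of `m` is `≥ k`. [folklore] -/
theorem const_increments (hg : ∀ j, g j = j * r + 2 * (m.map (fun x => min x j)).sum)
    (hpos : ∀ x ∈ m, 0 < x) {k c : ℕ} (hk : 1 ≤ k) (hinc : ∀ j < k, g (j + 1) = g j + c) :
    r + 2 * Multiset.card m = c ∧ ∀ x ∈ m, k ≤ x := by
  have h0 := hinc 0 (by omega)
  have i0 := succ_eq hg 0
  rw [Multiset.filter_eq_self.2 hpos] at i0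
  have hc : r + 2 * Multiset.card m = c := by omega
  refine ⟨hc, ?_⟩
  have h1 := hinc (k - 1) (by omega)
  have i1 := succ_eq hg (k - 1)
  have hcard : Multiset.card (m.filter (fun x => k - 1 < x)) = Multiset.card m := by omega
  have hfilt : m.filter (fun x => k - 1 < x) = m :=
    Multiset.eq_of_le_of_card_le (Multiset.filter_le _ _) hcard.ge
  intro x hx
  rw [← hfilt] at hx
  have := (Multiset.mem_filter.1 hx).2
  omega

/-- NO INCREMENT ABOVE `d`: if `g (d+1) = g d + c` with `c < 2` then `r = c` and every element of `m`
is `≤ d`. [folklore] -/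
theorem small_increment (hg : ∀ j, g j = j * r + 2 * (m.map (fun x => min x j)).sum) {d c : ℕ}
    (hc : c < 2) (hinc : g (d + 1) = g d + c) : r = c ∧ ∀ x ∈ m, x ≤ d := by
  have i := succ_eq hg d
  have hcard : Multiset.card (m.filter (fun x => d < x)) = 0 := by omega
  refine ⟨by omega, fun x hx => ?_⟩
  by_contra h
  have hmem : x ∈ m.filter (fun x => d < x) := Multiset.mem_filter.2 ⟨hx, by omega⟩
  rw [Multiset.card_eq_zero.1 hcard] at hmem
  exact Multiset.notMem_zero x hmem

/-- A multiset of positive naturals all `≤ 0` is empty. [folklore] -/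
theorem eq_zero_of_forall_le_zero (hpos : ∀ x ∈ m, 0 < x) (hle : ∀ x ∈ m, x ≤ 0) : m = 0 :=
  Multiset.eq_zero_of_forall_notMem fun x hx => by have := hpos x hx; have := hle x hx; omega

/-- **Clause (A)** (`r_C = 0`): `g j = j` for `j ≤ k`, `k ≥ 1` ⇒ `r = 1` and `m = 0`
("`rank G = 1`, `Ш(G)[p] = 0`"). [folklore; R1SHARP §5 (A)] -/
theorem clause_A (hg : ∀ j, g j = j * r + 2 * (m.map (fun x => min x j)).sum)
    (hpos : ∀ x ∈ m, 0 < x) {k : ℕ} (hk : 1 ≤ k) (hA : ∀ j ≤ k, g j = j) : r = 1 ∧ m = 0 := by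
  obtain ⟨hc, -⟩ := const_increments hg hpos hk (c := 1)
    (fun j hj => by rw [hA (j + 1) (by omega), hA j (by omega)])
  have hm : Multiset.card m = 0 := by omega
  exact ⟨by omega, Multiset.card_eq_zero.1 hm⟩

/-- **Clause (B)** (`r_C = 1`, depth `d < k`): `g j = 2j` on `[0, d]` and `g j = 2d` on `[d, k]` ⇒
`r = 0`, and `m = 0` if `d = 0`, `m = {d}` if `d > 0` ("`rank G = 0`, `Ш(G)[p^∞] ≅ (ℤ/p^d)²`
EXACTLY"). [folklore; R1SHARP §5 (B)] -/
theorem clause_B (hg : ∀ j, g j = j * r + 2 * (m.map (fun x => min x j)).sum)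
    (hpos : ∀ x ∈ m, 0 < x) {k d : ℕ} (hdk : d < k) (hB1 : ∀ j ≤ d, g j = 2 * j)
    (hB2 : ∀ j, d ≤ j → j ≤ k → g j = 2 * d) :
    r = 0 ∧ (d = 0 → m = 0) ∧ (0 < d → m = {d}) := by
  obtain ⟨hr, hle⟩ := small_increment hg (d := d) (c := 0) (by omega)
    (by rw [hB2 (d + 1) (by omega) (by omega), hB2 d le_rfl (by omega), Nat.add_zero])
  refine ⟨hr, fun hd => eq_zero_of_forall_le_zero hpos (by simpa [hd] using hle), fun hd => ?_⟩
  obtain ⟨hc, hge⟩ := const_increments hg hpos (k := d) (c := 2) hd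
    (fun j hj => by rw [hB1 (j + 1) (by omega), hB1 j (by omega)]; ring)
  have hm : Multiset.card m = 1 := by omega
  obtain ⟨x, rfl⟩ := Multiset.card_eq_one.1 hm
  have h1 := hle x (Multiset.mem_singleton_self x)
  have h2 := hge x (Multiset.mem_singleton_self x)
  rw [le_antisymm h1 h2]

/-- **Clause (C)** (`r_C = 1`, `d ≥ k`): `g j = 2j` on `[0, k]`, `k ≥ 1` ⇒ EITHER `r = 2 ∧ m = 0`
("`rank G = 2`, `Ш(G)[p] = 0`") OR `r = 0 ∧ m = {x}` with `x ≥ k` ("`rank G = 0`,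
`Ш(G)[p^∞] ≅ (ℤ/p^x)²`, `x ≥ k`"). [folklore; R1SHARP §5 (C)] -/
theorem clause_C (hg : ∀ j, g j = j * r + 2 * (m.map (fun x => min x j)).sum)
    (hpos : ∀ x ∈ m, 0 < x) {k : ℕ} (hk : 1 ≤ k) (hC : ∀ j ≤ k, g j = 2 * j) :
    (r = 2 ∧ m = 0) ∨ (r = 0 ∧ ∃ x, k ≤ x ∧ m = {x}) := by
  obtain ⟨hc, hge⟩ := const_increments hg hpos hk (c := 2)
    (fun j hj => by rw [hC (j + 1) (by omega), hC j (by omega)]; ring)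
  rcases Nat.eq_zero_or_pos (Multiset.card m) with h0 | hpos'
  · exact Or.inl ⟨by omega, Multiset.card_eq_zero.1 h0⟩
  · have hm : Multiset.card m = 1 := by omega
    obtain ⟨x, rfl⟩ := Multiset.card_eq_one.1 hm
    exact Or.inr ⟨by omega, x, hge x (Multiset.mem_singleton_self x), rfl⟩

/-- **Clause (D)** (`r_C = 2`, `d < k`): `g j = 3j` on `[0, d]` and `g j = j + 2d` on `[d, k]` ⇒ `r = 1`,
and `m = 0` if `d = 0`, `m = {d}` if `d > 0` ("`rank G = 1`, `Ш(G)[p^∞] ≅ (ℤ/p^d)²`").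
[folklore; R1SHARP §5 (D)] -/
theorem clause_D (hg : ∀ j, g j = j * r + 2 * (m.map (fun x => min x j)).sum)
    (hpos : ∀ x ∈ m, 0 < x) {k d : ℕ} (hdk : d < k) (hD1 : ∀ j ≤ d, g j = 3 * j)
    (hD2 : ∀ j, d ≤ j → j ≤ k → g j = j + 2 * d) :
    r = 1 ∧ (d = 0 → m = 0) ∧ (0 < d → m = {d}) := by
  obtain ⟨hr, hle⟩ := small_increment hg (d := d) (c := 1) (by omega)
    (by rw [hD2 (d + 1) (by omega) (by omega), hD2 d le_rfl (by omega)]; ring)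
  refine ⟨hr, fun hd => eq_zero_of_forall_le_zero hpos (by simpa [hd] using hle), fun hd => ?_⟩
  obtain ⟨hc, hge⟩ := const_increments hg hpos (k := d) (c := 3) hd
    (fun j hj => by rw [hD1 (j + 1) (by omega), hD1 j (by omega)]; ring)
  have hm : Multiset.card m = 1 := by omega
  obtain ⟨x, rfl⟩ := Multiset.card_eq_one.1 hm
  have h1 := hle x (Multiset.mem_singleton_self x)
  have h2 := hge x (Multiset.mem_singleton_self x)
  rw [le_antisymm h1 h2]

/-- **Clause (E)** (`r_C = 2`, `d ≥ k`): `g j = 3j` on `[0, k]`, `k ≥ 1` ⇒ EITHER `r = 3 ∧ m = 0` OR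
`r = 1 ∧ m = {x}` with `x ≥ k`. [folklore; R1SHARP §5 (E)] -/
theorem clause_E (hg : ∀ j, g j = j * r + 2 * (m.map (fun x => min x j)).sum)
    (hpos : ∀ x ∈ m, 0 < x) {k : ℕ} (hk : 1 ≤ k) (hE : ∀ j ≤ k, g j = 3 * j) :
    (r = 3 ∧ m = 0) ∨ (r = 1 ∧ ∃ x, k ≤ x ∧ m = {x}) := by
  obtain ⟨hc, hge⟩ := const_increments hg hpos hk (c := 3)
    (fun j hj => by rw [hE (j + 1) (by omega), hE j (by omega)]; ring)
  rcases Nat.eq_zero_or_pos (Multiset.card m) with h0 | hpos'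
  · exact Or.inl ⟨by omega, Multiset.card_eq_zero.1 h0⟩
  · have hm : Multiset.card m = 1 := by omega
    obtain ⟨x, rfl⟩ := Multiset.card_eq_one.1 hm
    exact Or.inr ⟨by omega, x, hge x (Multiset.mem_singleton_self x), rfl⟩

end Summit.BirchSwinnertonDyer.Rank1Residual.O5.GrowthIncrements
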